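import Mathlib.Analysis.Calculus.ContDiff.Basic
import Literature.ModelTheory.ExponentialFields.SemialgebraicTriangulation
import HarnessLib

/-!
# `C¹`-triangulations of compact semialgebraic sets (Ohmoto–Shiota 2017)

Cite item wi-15726 (family `periods`, route `KontsevichZagierPeriods/CobordismMove`, items
`CobordismInvariance` stmt-6762 and `SignatureSector` stmt-6791: to produce `C¹` fundamental cycles and
bounding chains of compact semialgebraic sets on which the cube/simplex Stokes theorem applies).

The vocabulary is that of `SemialgebraicTriangulation.lean` (this directory), where the plain
triangulation theorems were reviewed but deliberately not vendored for want of a consumer ("A route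
that needs the triangulation theorem … should request it as a cite item"): finite geometric simplicial
complexes `K : Geometry.SimplicialComplex ℝ (Fin n → ℝ)` (Mathlib) with polyhedron `K.space = |K|`,
open simplices `openSimplex ℝ σ`, and semialgebraic homeomorphisms `IsSemialgHomeomorphOn ℝ S T Φ Ψ`
(`Φ : S → T` a homeomorphism with inverse `Ψ`, graph of `Φ` over `S` semialgebraic).

## Source, read at the cited places (arXiv:1505.03970 = J. Topology 10 (2017) 765–775)

T. Ohmoto, M. Shiota, *`C¹`-triangulations of semialgebraic sets*:

* §1.1, definitions: "a semialgebraic `Cᵏ` map `X → Y` is the restriction of a semialgebraic map of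
  class `Cᵏ` from some semialgebraic open neighborhood of `X` in `ℝᵐ` to `ℝⁿ`; in fact, we can extend
  it to `ℝᵐ → ℝⁿ`"; "a semialgebraic triangulation of a locally closed semialgebraic set `X` means the
  pair of a locally finite simplicial complex `K` and a semialgebraic homeomorphism `f : |K| → X`".
* **Theorem 1.1.** "For a locally closed semialgebraic set `X`, there exists a semialgebraic
  triangulation `(K, f)` so that the map `f : |K| → X` is of class `C¹`" (a *triangulation with `C¹`
  realization*; "It follows that … the differential `d(f|_σ)` exists and is continuous on `σ`, while as
  a cost for that, `d(f|_σ)` may drop the rank along the boundary `∂σ` and some smaller dimensional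
  semialgebraic subset of `Int(σ)`"). For compact `X`, `K` is a finite complex (§1.2).
* **Theorem 2.2** (Łojasiewicz): a triangulation `(K, h)` with `{h(Int σ)}` a semialgebraic `Cᵏ`
  stratification of `X` compatible with a given finite family `𝒜` of semialgebraic subsets, and
  **Theorem 3.1** (panel beating): for ANY semialgebraic triangulation `(K, f)` there is a semialgebraic
  homeomorphism `χ` of `|K|` preserving every `σ ∈ K` with `f ∘ χ` of class `C¹` — "Theorem 1.1 is the
  case `X = Y` and `φ = id_X`". Applying 3.1 to a triangulation of 2.2 keeps the compatibility with `𝒜`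
  (`χ` preserves each open simplex), which is the form vendored below.
* §1.1: the proof "will carefully be done to be valid for any general real closed field `R`".

## What is vendored and what is NOT

`OhmotoShiota2017_c1Triangulation` (named fact, D-0014): every COMPACT semialgebraic `X ⊆ ℝᴺ` with a
finite family `𝒜` of semialgebraic subsets admits a finite simplicial complex `K` in some `ℝⁿ` and a
map `f : ℝⁿ → ℝᴺ` of class `C¹` (globally — the printed `C¹` realization extends to `ℝⁿ`) restricting
to a semialgebraic homeomorphism `|K| → X` (inverse `g`) such that every `A ∈ 𝒜` is a union of images
`f(Int σ)` of open simplices. NOT vendored, because NOT printed (the requesting item over-asks here):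
(i) that `f|_σ` is a `C¹` EMBEDDING / immersion on closed or open simplices — the paper lists "whether
or not we can choose `f` so that the restriction to `Int(σ)` is a semialgebraic `C¹` embedding" as
OPEN and warns that `d(f|_σ)` may drop rank; (ii) Nash (`C^ω`) regularity of the same `f` on open
simplices (Łojasiewicz's `h` has `Cᵏ` strata, but only `C¹` survives the panel beating); (iii) a
`ℚ`-semialgebraic version (input and output over `ℚ`): in print only through the remark that the proof
works over any real closed field (apply it over the real closure of `ℚ` and transfer) — a scope caveat
for the consumer, not a vendored statement; (iv) locally closed non-compact `X` (locally finite `K`).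
For pulling back differential forms to simplices and Stokes (the paper's own application, §1.2 and
Thm. 4.1: `∫_{f(σ)} ω := ∫_σ (f|_σ)^*ω`), the `C¹` realization is exactly what is used.

## References

* [OhmotoShiota2017] T. Ohmoto, M. Shiota, J. Topology 10 (2017), Thm. 1.1, Thm. 2.2, Thm. 3.1,
  Cor. 3.3, §4.1 (arXiv:1505.03970, read).
* [BCR1998] J. Bochnak, M. Coste, M.-F. Roy, Real Algebraic Geometry, Thm. 9.2.1 (semialgebraic
  triangulation over any real closed field).
* [Shiota1997] M. Shiota, Geometry of Subanalytic and Semialgebraic Sets, Thm. II.2.1.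
-/

noncomputable section

open Set

namespace Literature.ModelTheory.ExponentialFields

/-- The open simplices of a geometric simplicial complex cover its polyhedron: a point of a closed
simplex lies in the open simplex spanned by the vertices carrying positive barycentric weight (a face,
by down-closure). [cite: Dries1998, Ch. 8 (1.5)] -/
theorem exists_mem_openSimplex_of_mem_space {E : Type*} [AddCommGroup E] [Module ℝ E]
    {K : Geometry.SimplicialComplex ℝ E} {x : E} (hx : x ∈ K.space) :
    ∃ σ ∈ K.faces, x ∈ openSimplex ℝ σ := by
  classical
  obtain ⟨s, hs, hxs⟩ := Geometry.SimplicialComplex.mem_space_iff.1 hx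
  obtain ⟨w, hw0, hw1, hsum⟩ := Finset.mem_convexHull'.1 hxs
  have hpos : ∀ y ∈ s, w y ≠ 0 → 0 < w y := fun y hy hne ↦ lt_of_le_of_ne (hw0 y hy) (Ne.symm hne)
  have h1 : ∑ y ∈ s with 0 < w y, w y = 1 := by
    rw [Finset.sum_filter_of_ne fun y hy hne ↦ hpos y hy hne, hw1]
  have h2 : ∑ y ∈ s with 0 < w y, w y • y = x := by
    rw [Finset.sum_filter_of_ne fun y hy hne ↦ hpos y hy (by rintro h0; simp [h0] at hne), hsum]
  have hne : (s.filter fun y ↦ 0 < w y).Nonempty := by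
    by_contra h
    rw [Finset.not_nonempty_iff_eq_empty] at h
    rw [h, Finset.sum_empty] at h1
    exact zero_ne_one h1
  refine ⟨s.filter fun y ↦ 0 < w y, K.down_closed hs (Finset.filter_subset _ _) hne, ?_⟩
  exact ⟨w, fun y hy ↦ (Finset.mem_filter.1 hy).2, h1, h2⟩

/-- **Ohmoto–Shiota 2017, Thm. 1.1 (with Thm. 2.2 and Thm. 3.1): `C¹` triangulation of compact
semialgebraic sets, compatible with finitely many semialgebraic subsets.** For every compact
semialgebraic `X ⊆ ℝᴺ` and every finite family `𝒜` of semialgebraic subsets of `X` there are a FINITE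
geometric simplicial complex `K` in some `ℝⁿ`, a map `f : ℝⁿ → ℝᴺ` of class `C¹` and `g : ℝᴺ → ℝⁿ` such
that `f` restricts to a semialgebraic homeomorphism `|K| → X` with inverse `g` (a semialgebraic
triangulation `(K, f)` of `X` "with `C¹` realization": each `f|_σ` is `C¹` on the CLOSED simplex `σ`,
its differential possibly dropping rank on `∂σ`), and every `A ∈ 𝒜` is a union of the images
`f(Int σ)`, `σ ∈ K`, of open simplices (compatibility, from Łojasiewicz's triangulation Thm. 2.2, kept
by the panel beating of Thm. 3.1 which preserves every simplex). Printed over `ℝ` (indeed over any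
real closed field); no embedding/immersion or Nash property of `f` on simplices is asserted (open,
loc. cit. §1.1). [cite: OhmotoShiota2017, Thm. 1.1 with Thm. 2.2 and Thm. 3.1] -/
def OhmotoShiota2017_c1Triangulation : Prop :=
  ∀ (N : ℕ) (X : Set (Fin N → ℝ)), IsSemialgebraic ℝ X → IsCompact X →
    ∀ 𝒜 : Finset (Set (Fin N → ℝ)), (∀ A ∈ 𝒜, A ⊆ X ∧ IsSemialgebraic ℝ A) →
      ∃ (n : ℕ) (K : Geometry.SimplicialComplex ℝ (Fin n → ℝ)) (f : (Fin n → ℝ) → (Fin N → ℝ))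
        (g : (Fin N → ℝ) → (Fin n → ℝ)),
        K.faces.Finite ∧ IsSemialgHomeomorphOn ℝ K.space X f g ∧ ContDiff ℝ 1 f ∧
          ∀ A ∈ 𝒜, ∀ σ ∈ K.faces, (f '' openSimplex ℝ σ ∩ A).Nonempty → f '' openSimplex ℝ σ ⊆ A

namespace OhmotoShiota2017_c1Triangulation

variable {N : ℕ} {X : Set (Fin N → ℝ)}

/-- The absolute form (Thm. 1.1 verbatim for compact `X`, no family of subsets): a finite complex
`K` and a `C¹` map restricting to a semialgebraic homeomorphism `|K| → X`.
[cite: OhmotoShiota2017, Thm. 1.1] -/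
theorem absolute (h : OhmotoShiota2017_c1Triangulation) (hX : IsSemialgebraic ℝ X)
    (hc : IsCompact X) :
    ∃ (n : ℕ) (K : Geometry.SimplicialComplex ℝ (Fin n → ℝ)) (f : (Fin n → ℝ) → (Fin N → ℝ))
      (g : (Fin N → ℝ) → (Fin n → ℝ)),
      K.faces.Finite ∧ IsSemialgHomeomorphOn ℝ K.space X f g ∧ ContDiff ℝ 1 f := by
  obtain ⟨n, K, f, g, hK, hfg, hf, -⟩ := h N X hX hc ∅ (by simp)
  exact ⟨n, K, f, g, hK, hfg, hf⟩

/-- Consequences of the `C¹` realization used for pulling back forms: `f` is `C¹` on every closed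
simplex `convexHull σ` (indeed everywhere), and continuous. [cite: OhmotoShiota2017, §1.2] -/
theorem contDiffOn_convexHull {n : ℕ} {f : (Fin n → ℝ) → (Fin N → ℝ)} (hf : ContDiff ℝ 1 f)
    (σ : Finset (Fin n → ℝ)) : ContDiffOn ℝ 1 f (convexHull ℝ (σ : Set (Fin n → ℝ))) :=
  hf.contDiffOn

/-- The image of the polyhedron is the whole set: `f(|K|) = X`. [cite: OhmotoShiota2017, Thm. 1.1] -/
theorem image_space_eq {n : ℕ} {K : Geometry.SimplicialComplex ℝ (Fin n → ℝ)}
    {f : (Fin n → ℝ) → (Fin N → ℝ)} {g : (Fin N → ℝ) → (Fin n → ℝ)}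
    (hfg : IsSemialgHomeomorphOn ℝ K.space X f g) : f '' K.space = X :=
  hfg.image_eq

/-- Compatibility in "union of strata" form: granted the fact's conclusion for `A ∈ 𝒜`, `A` is the
union of the images of the open simplices it meets. (Uses that the open simplices of `K` cover `|K|`
— every point of a closed simplex lies in the open simplex of the face spanned by the vertices with
positive barycentric weight — and `f(|K|) = X ⊇ A`.) [cite: OhmotoShiota2017, Thm. 2.2] -/
theorem eq_biUnion_of_compatible {n : ℕ} {K : Geometry.SimplicialComplex ℝ (Fin n → ℝ)}
    {f : (Fin n → ℝ) → (Fin N → ℝ)} {g : (Fin N → ℝ) → (Fin n → ℝ)}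
    (hfg : IsSemialgHomeomorphOn ℝ K.space X f g) {A : Set (Fin N → ℝ)} (hA : A ⊆ X)
    (hcomp : ∀ σ ∈ K.faces, (f '' openSimplex ℝ σ ∩ A).Nonempty → f '' openSimplex ℝ σ ⊆ A) :
    A = ⋃ σ ∈ {σ ∈ K.faces | (f '' openSimplex ℝ σ ∩ A).Nonempty}, f '' openSimplex ℝ σ := by
  apply Subset.antisymm
  · intro a ha
    -- `a = f x` with `x ∈ |K|`, and `x` lies in the open simplex of some face
    have hx : a ∈ f '' K.space := by rw [hfg.image_eq]; exact hA ha
    obtain ⟨x, hxK, rfl⟩ := hx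
    obtain ⟨σ, hσ, hxσ⟩ := exists_mem_openSimplex_of_mem_space hxK
    refine mem_iUnion₂.2 ⟨σ, ⟨hσ, ⟨f x, ⟨x, hxσ, rfl⟩, ha⟩⟩, ⟨x, hxσ, rfl⟩⟩
  · exact iUnion₂_subset fun σ hσ ↦ hcomp σ hσ.1 hσ.2

end OhmotoShiota2017_c1Triangulation

end Literature.ModelTheory.ExponentialFields

end
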